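import Literature.Probability.RandomPlanarGeometry.HexSAWBridges
import Literature.Probability.RandomPlanarGeometry.HexSAWStripIdentity
import Literature.Probability.RandomPlanarGeometry.HexSAWTheorem1
import Mathlib.Analysis.SpecialFunctions.Pow.Real
import Mathlib.Analysis.Convex.SpecificFunctions.Basic
import Mathlib.Algebra.Order.Field.GeomSum
import HarnessLib

/-!
# The Hammersley–Welsh bound on the honeycomb lattice with the critical bridge weights kept:
# master inequality, explicit all-`n` form, and the decay ⇒ stretched-exponent engine

Topic `Literature/Probability/RandomPlanarGeometry`. Sources: J. M. Hammersley, D. J. A. Welsh,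
*Further results on the rate of convergence to the connective constant of the hypercubical
lattice*, Quart. J. Math. Oxford 13 (1962) 108–110 (the decomposition of a walk into bridges of
monotone widths, `c_n ≤ e^{κ√n} μ^n`); H. Duminil-Copin, S. Smirnov, *The connective constant of the
honeycomb lattice equals `√(2+√2)`*, Ann. of Math. 175 (2012), §3, proof of Theorem 1 ("a bridge of
width `T` has length at least `T`, we obtain for `x < x_c`: `B_T^x ≤ (x/x_c)^T B_T^{x_c} ≤ (x/x_c)^T`
… `Z(x) ≤ 2 ∏_T (1 + B_T^x)² < ∞`"); N. Madras, G. Slade, *The Self-Avoiding Walk* (1993), §3.1,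
Theorem 3.1.4 / (3.1.11)–(3.1.14) (the Hammersley–Welsh argument); H. Duminil-Copin, S. Ganguly,
A. Hammond, I. Manolescu, *Bounding the number of self-avoiding walks: Hammersley–Welsh with polygon
insertion*, Ann. Probab. 48 (2020) (arXiv:1809.00760), Theorem 1.3 (p. 3: "Let `ε ∈ (0, 1/42)`. Then,
for any `n ∈ ℕ` high enough, `|SAW_n(ℍ)| ≤ exp(n^{1/2−ε}) μ(ℍ)^n`" — the printed comparison point,
non-explicit threshold); D. Krachun, C. Panagiotis, *Quantitative sub-ballisticity of self-avoiding
walk on the hexagonal lattice*, Ann. Probab. (2026) (arXiv:2310.17299), Theorem 2 (p. 3: "Let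
`ε = 10^{-10}`. For every `T ≥ 1` we have `B_T ≤ 100 · T^{-ε}`") and §1 (the Hammersley–Welsh argument
with a polynomial decay of `B_T`).

The tree's `HexSAWBridges.lean` proves `Z(x) < ∞` for `x < x_c` with the CRUDE bridge bound
`bSum M s x ≤ 2x⁻³(x/x_c)^s` (critical bridge mass `≤ 1`). This file keeps the critical masses
`B_T(x_c) = HV.stripBlim T` inside the product, which is what every quantitative improvement of
Hammersley–Welsh consumes:

* `bSum_le_lim` — level-width-`s` bridges from the two standard vertices have `x`-mass at most
  `2x⁻³ (x/x_c)^{2T} B_T(x_c)`, `T = ⌊s/2⌋ + 1` (DCS: "`B_T^x ≤ (x/x_c)^T B_T^{x_c}`", with the tree's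
  level/width dictionary: DCS width `T` = level-widths `2T−1, 2T`, at least `2T` vertices);
* **`hexSawCount_mul_pow_le_exp` (MASTER INEQUALITY)** — for `0 < x ≤ x_c` and every `n`,
  `c_n xⁿ ≤ 4x⁻¹ · exp(8x⁻³ Σ_{T=1}^{n+1} (x/x_c)^{2T} B_T(x_c))`;
* **`hexSawCount_le_exp_of_le_half` (HAMMERSLEY–WELSH FORM)** — for `0 < t ≤ 1/2` and every `n`,
  `c_n ≤ 8μ · exp(2nt + 64μ³ Σ_{T=1}^{n+1} (1−t)^{2T} B_T(x_c)) · μⁿ`, `μ = μ_ℍ = √(2+√2)`;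
* `HexHWExplicit A κ` (`c_n ≤ A e^{κ√n} μⁿ`, `n ≥ 1`), `HexHWStretched A K θ` (`c_n ≤ A e^{K n^θ} μⁿ`),
  `BridgeDecay C η` (`B_T(x_c) ≤ C T^{-η}`, `T ≥ 1`) — the statement shapes of lane «pcv-sawmu»
  Sketch_G11 §R55;
* **`hexHWStretched_explicit_of_bridgeDecay` / `hexHWStretched_of_bridgeDecay` (THE ENGINE)** —
  `0 < C → 0 < η < 1 → BridgeDecay C η → HexHWStretched (8μ) (1 + 128μ³C(2^{1−η}/(1−η)+1)) ((1−η)/(2−η))`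
  (and the `∃ A K` form): a polynomial decay of the critical bridge masses turns
  `√n` into `n^{(1−η)/(2−η)}` for ALL `n ≥ 1` (sum bound `Σ_{T≥1} e^{-2tT} T^{-η} ≤ (2/(1−η)+1) t^{η−1}`
  by a Bernoulli-inequality induction, then `t := ½ n^{-1/(2−η)}`).

No named facts are introduced: `BridgeDecay C η` is a hypothesis schema. Inputs available in the
tree: Krachun–Panagiotis' Theorem 2 with an explicit exponent is the Summits-side theorem
`KPExplicit.stripBlim_decay_explicit` (`∀ T ≥ 1, B_T ≤ 200·T^{-(7/10⁹)}`, i.e. `BridgeDecay 200 (7/10⁹)`;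
the instance of the engine on it lives next to it, Summits side, since Literature may not import
Summits); the logarithmic input `B_T ≤ 5(ln T)^{-1/3}` is `HexSAWBridgeLogDecay.lean`, consumed in
`HexSAWHammersleyWelshLog.lean` (`c_n ≤ A exp(K√n (ln n)^{-1/6}) μⁿ` for all `n ≥ 2`, hence
`∀ κ > 0, ∃ A, HexHWExplicit A κ`).

Printed status: the mechanism is Hammersley–Welsh 1962 / Duminil-Copin–Smirnov §3 / DCGHM §1 / KP §1;
an explicit all-`n` honeycomb statement with the critical masses as free inputs, and the typed engine
with `K` explicit in `(C, η)`, are bookkeeping not found in print as statements (lane «pcv-sawmu»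
route R55, a-idea-1 ROUTES-G11 §R55; printed-status cells lit-1 g7 2026-08-22).
-/

noncomputable section

open Finset Filter Topology

namespace Literature.Probability.RandomPlanarGeometry.SAW

open HV

/-! ### `μ_ℍ = x_c⁻¹` -/

/-- `μ_ℍ = x_c⁻¹ = √(2+√2)` (Duminil-Copin–Smirnov's Theorem 1, a tree theorem).
[cite: DuminilCopinSmirnov2012, Thm 1] -/
theorem hexConnectiveConstant_eq_inv : hexConnectiveConstant = hexCriticalFugacity⁻¹ := by
  rw [hexConnectiveConstant_eq_of_thm1 DuminilCopinSmirnov2012_thm1_holds, hexCriticalFugacity, inv_inv]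

/-- `1 ≤ μ_ℍ`. [cite: DuminilCopinSmirnov2012, Thm 1] -/
theorem one_le_hexConnectiveConstant : 1 ≤ hexConnectiveConstant := by
  rw [hexConnectiveConstant_eq_inv]
  exact (one_le_inv₀ hexCriticalFugacity_pos_lt_one.1).2 hexCriticalFugacity_pos_lt_one.2.le

/-! ### Bridges of level-width `s` against the critical strip masses `B_T(x_c)` -/

section Master

variable {x : ℝ}

/-- The weight `(x/x_c)^{2T} B_T(x_c)` is non-increasing in `T ≥ 1` (`x ≤ x_c`, `B_{T+1} ≤ B_T`).
[cite: KrachunPanagiotis2026, Lemma 2.3] -/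
theorem pow_mul_stripBlim_succ_le {T : ℕ} (hT : 1 ≤ T) (hx : 0 ≤ x) (hxc : x ≤ hexCriticalFugacity) :
    (x / hexCriticalFugacity) ^ (2 * (T + 1)) * stripBlim (T + 1) ≤
      (x / hexCriticalFugacity) ^ (2 * T) * stripBlim T := by
  have hxc0 := hexCriticalFugacity_pos_lt_one.1
  have hρ0 : 0 ≤ x / hexCriticalFugacity := div_nonneg hx hxc0.le
  have hρ1 : x / hexCriticalFugacity ≤ 1 := (div_le_one hxc0).2 hxc
  exact mul_le_mul (pow_le_pow_of_le_one hρ0 hρ1 (by omega)) (stripBlim_succ_le hT)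
    (stripBlim_nonneg (by omega)) (pow_nonneg hρ0 _)

/-- Odd level-width `2T − 1` from `O` (= DCS width `T`): `Σ x^{#steps} ≤ x⁻¹ (x/x_c)^{2T} B_T(x_c)`
("`B_T^x ≤ (x/x_c)^T B_T^{x_c}`", a bridge of width `T` having at least `2T` vertices in the tree's
two-levels-per-row convention). [cite: DuminilCopinSmirnov2012, §3 (proof of Theorem 1)] -/
theorem wt_brFin_odd_le_lim {T : ℕ} (hT : 1 ≤ T) (M : ℕ) (hx : 0 < x) (hxc : x ≤ hexCriticalFugacity) :
    wt x (brFin hvOrigin M (2 * (T : ℤ) - 1)) ≤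
      x⁻¹ * ((x / hexCriticalFugacity) ^ (2 * T) * stripBlim T) := by
  have hxc0 := hexCriticalFugacity_pos_lt_one.1
  refine (wt_brFin_odd_le hT M hx).trans (mul_le_mul_of_nonneg_left ?_ (inv_nonneg.2 hx.le))
  exact (stripB_le_pow_mul hT M hx.le hxc hxc0).trans
    (mul_le_mul_of_nonneg_left (stripB_le_lim DuminilCopinSmirnov2012_lemma2_holds hT M)
      (pow_nonneg (div_nonneg hx.le hxc0.le) _))

/-- Even level-width `2T` from `O`: one more step makes a bridge of width `T + 1`, so
`Σ x^{#steps} ≤ x⁻² (x/x_c)^{2(T+1)} B_{T+1}(x_c)`. [cite: DuminilCopinSmirnov2012, §3 (proof of Theorem 1)] -/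
theorem wt_brFin_even_le_lim (T M : ℕ) (hx : 0 < x) (hxc : x ≤ hexCriticalFugacity) :
    wt x (brFin hvOrigin M (2 * (T : ℤ))) ≤
      x⁻¹ * (x⁻¹ * ((x / hexCriticalFugacity) ^ (2 * (T + 1)) * stripBlim (T + 1))) := by
  refine (wt_brFin_even_le T M hx).trans (mul_le_mul_of_nonneg_left ?_ (inv_nonneg.2 hx.le))
  have h := wt_brFin_odd_le_lim (T := T + 1) (by omega) (M + 1) hx hxc
  have e : (2 * ((T + 1 : ℕ) : ℤ) - 1) = 2 * (T : ℤ) + 1 := by push_cast; ring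
  rwa [e] at h

/-- **Level-width `s ≥ 1` bridges from the two standard vertices carry `x`-mass at most
`2x⁻³ (x/x_c)^{2T} B_T(x_c)`, `T = ⌊s/2⌋ + 1`** (the width-`T` DCS bridges behind the level-width-`s`
ones; `B_{T+1} ≤ B_T`, `x ≤ 1`). [cite: DuminilCopinSmirnov2012, §3 (proof of Theorem 1)] -/
theorem bSum_le_lim {s : ℕ} (hs : 1 ≤ s) (M : ℕ) (hx : 0 < x) (hxc : x ≤ hexCriticalFugacity) :
    bSum M s x ≤ 2 * x⁻¹ ^ 3 * ((x / hexCriticalFugacity) ^ (2 * (s / 2 + 1)) * stripBlim (s / 2 + 1)) := by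
  have hxc0 := hexCriticalFugacity_pos_lt_one.1
  have hx1 : x ≤ 1 := hxc.trans hexCriticalFugacity_pos_lt_one.2.le
  have hinv1 : 1 ≤ x⁻¹ := (one_le_inv₀ hx).2 hx1
  have hi0 : 0 ≤ x⁻¹ := inv_nonneg.2 hx.le
  have hi12 : x⁻¹ ≤ x⁻¹ ^ 3 := le_self_pow₀ hinv1 (by norm_num)
  have hi23 : x⁻¹ * x⁻¹ ≤ x⁻¹ ^ 3 := by
    rw [← sq]; exact pow_le_pow_right₀ hinv1 (by norm_num)
  set u : ℕ → ℝ := fun T => (x / hexCriticalFugacity) ^ (2 * T) * stripBlim T with hu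
  have hu0 : ∀ T, 1 ≤ T → 0 ≤ u T := fun T hT =>
    mul_nonneg (pow_nonneg (div_nonneg hx.le hxc0.le) _) (stripBlim_nonneg hT)
  rw [bSum, stdPt_false]
  rcases Nat.even_or_odd s with ⟨r, hr⟩ | ⟨r, hr⟩
  · -- even `s = 2r`, `r ≥ 1`, `T = r + 1`
    have hr1 : 1 ≤ r := by omega
    have hdiv : s / 2 + 1 = r + 1 := by omega
    have hs' : (s : ℤ) = 2 * (r : ℤ) := by rw [hr]; push_cast; ring
    rw [hdiv, hs']
    have h1 := wt_brFin_even_le_lim r M hx hxc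
    have h2 := wt_brFin_true_le (x := x) (2 * (r : ℤ)) M hx
    have h3 := wt_brFin_odd_le_lim (x := x) (T := r + 1) (by omega) (M + 1) hx hxc
    have e : (2 * ((r + 1 : ℕ) : ℤ) - 1) = 2 * (r : ℤ) + 1 := by push_cast; ring
    rw [e] at h3
    have hur := hu0 (r + 1) (by omega)
    calc wt x (brFin hvOrigin M (2 * (r : ℤ))) + wt x (brFin (stdPt true) M (2 * (r : ℤ)))
        ≤ x⁻¹ * (x⁻¹ * u (r + 1)) + x⁻¹ * (x⁻¹ * u (r + 1)) :=
          add_le_add h1 (h2.trans (mul_le_mul_of_nonneg_left h3 hi0))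
      _ = 2 * (x⁻¹ * x⁻¹) * u (r + 1) := by ring
      _ ≤ 2 * x⁻¹ ^ 3 * u (r + 1) := by
          exact mul_le_mul_of_nonneg_right (mul_le_mul_of_nonneg_left hi23 (by norm_num)) hur
  · -- odd `s = 2r + 1 = 2(r+1) - 1`, `T = r + 1`
    have hdiv : s / 2 + 1 = r + 1 := by omega
    have hs' : (s : ℤ) = 2 * ((r + 1 : ℕ) : ℤ) - 1 := by rw [hr]; push_cast; ring
    rw [hdiv, hs']
    have h1 := wt_brFin_odd_le_lim (x := x) (T := r + 1) (by omega) M hx hxc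
    have h2 := wt_brFin_true_le (x := x) (2 * ((r + 1 : ℕ) : ℤ) - 1) M hx
    have e : (2 * ((r + 1 : ℕ) : ℤ) - 1 + 1) = 2 * ((r + 1 : ℕ) : ℤ) := by ring
    rw [e] at h2
    have h3 := wt_brFin_even_le_lim (x := x) (r + 1) (M + 1) hx hxc
    have h4 : u (r + 1 + 1) ≤ u (r + 1) := pow_mul_stripBlim_succ_le (by omega) hx.le hxc
    have hur := hu0 (r + 1) (by omega)
    have hur2 := hu0 (r + 1 + 1) (by omega)
    calc wt x (brFin hvOrigin M (2 * ((r + 1 : ℕ) : ℤ) - 1)) +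
          wt x (brFin (stdPt true) M (2 * ((r + 1 : ℕ) : ℤ) - 1))
        ≤ x⁻¹ * u (r + 1) + x⁻¹ * (x⁻¹ * (x⁻¹ * u (r + 1 + 1))) :=
          add_le_add h1 (h2.trans (mul_le_mul_of_nonneg_left h3 hi0))
      _ ≤ x⁻¹ ^ 3 * u (r + 1) + x⁻¹ ^ 3 * u (r + 1) := by
          refine add_le_add (mul_le_mul_of_nonneg_right hi12 hur) ?_
          rw [← mul_assoc, ← mul_assoc, show x⁻¹ * x⁻¹ * x⁻¹ = x⁻¹ ^ 3 by ring]
          exact mul_le_mul_of_nonneg_left h4 (by positivity)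
      _ = 2 * x⁻¹ ^ 3 * u (r + 1) := by ring

/-- Pairing consecutive indices: `Σ_{s < 2S} g(s) = Σ_{j < S} (g(2j) + g(2j+1))`. [folklore] -/
private theorem sum_range_two_mul (g : ℕ → ℝ) (S : ℕ) :
    ∑ s ∈ range (2 * S), g s = ∑ j ∈ range S, (g (2 * j) + g (2 * j + 1)) := by
  induction S with
  | zero => simp
  | succ S ih =>
    rw [show 2 * (S + 1) = 2 * S + 1 + 1 by ring, sum_range_succ, sum_range_succ, ih, sum_range_succ]
    ring

/-- **Summing over level-widths: `Σ_{s=1}^{S} bSum_s(x) ≤ 4x⁻³ Σ_{T=1}^{S} (x/x_c)^{2T} B_T(x_c)`**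
(each DCS width `T` is hit by the two level-widths `2T−1`, `2T`).
[cite: DuminilCopinSmirnov2012, §3 (proof of Theorem 1)] -/
theorem sum_bSum_le_lim (M S : ℕ) (hx : 0 < x) (hxc : x ≤ hexCriticalFugacity) :
    ∑ s ∈ range S, bSum M (s + 1) x ≤ 4 * x⁻¹ ^ 3 *
      ∑ T ∈ range S, (x / hexCriticalFugacity) ^ (2 * (T + 1)) * stripBlim (T + 1) := by
  have hxc0 := hexCriticalFugacity_pos_lt_one.1
  set u : ℕ → ℝ := fun T => (x / hexCriticalFugacity) ^ (2 * T) * stripBlim T with hu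
  have hu0 : ∀ T, 1 ≤ T → 0 ≤ u T := fun T hT =>
    mul_nonneg (pow_nonneg (div_nonneg hx.le hxc0.le) _) (stripBlim_nonneg hT)
  have hterm : ∀ s ∈ range S, bSum M (s + 1) x ≤ 2 * x⁻¹ ^ 3 * u ((s + 1) / 2 + 1) := by
    intro s _
    have := bSum_le_lim (s := s + 1) (by omega) M hx hxc
    push_cast at this
    exact this
  have hpair : ∑ s ∈ range S, u ((s + 1) / 2 + 1) ≤ 2 * ∑ T ∈ range S, u (T + 1) := by
    calc ∑ s ∈ range S, u ((s + 1) / 2 + 1) ≤ ∑ s ∈ range (2 * S), u ((s + 1) / 2 + 1) :=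
          sum_le_sum_of_subset_of_nonneg (range_subset_range.2 (by omega))
            fun s _ _ => hu0 _ (by omega)
      _ = ∑ j ∈ range S, (u (j + 1) + u (j + 2)) := by
          rw [sum_range_two_mul]
          refine sum_congr rfl fun j _ => ?_
          rw [show (2 * j + 1) / 2 + 1 = j + 1 by omega, show (2 * j + 1 + 1) / 2 + 1 = j + 2 by omega]
      _ ≤ ∑ j ∈ range S, (u (j + 1) + u (j + 1)) :=
          sum_le_sum fun j _ => add_le_add le_rfl (pow_mul_stripBlim_succ_le (by omega) hx.le hxc)
      _ = 2 * ∑ T ∈ range S, u (T + 1) := by rw [mul_sum]; exact sum_congr rfl fun _ _ => by ring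
  calc ∑ s ∈ range S, bSum M (s + 1) x ≤ ∑ s ∈ range S, 2 * x⁻¹ ^ 3 * u ((s + 1) / 2 + 1) :=
        sum_le_sum hterm
    _ = 2 * x⁻¹ ^ 3 * ∑ s ∈ range S, u ((s + 1) / 2 + 1) := by rw [mul_sum]
    _ ≤ 2 * x⁻¹ ^ 3 * (2 * ∑ T ∈ range S, u (T + 1)) :=
        mul_le_mul_of_nonneg_left hpair (by positivity)
    _ = _ := by ring

/-- `∏_{s=1}^{S} (1 + bSum_s(x)) ≤ exp(4x⁻³ Σ_{T=1}^{S} (x/x_c)^{2T} B_T(x_c))` ("the series `Σ_T B_T^x`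
converges and so does the product `∏_T (1 + B_T^x)`"). [cite: DuminilCopinSmirnov2012, §3 (proof of Theorem 1)] -/
theorem prod_bSum_le_exp_lim (M S : ℕ) (hx : 0 < x) (hxc : x ≤ hexCriticalFugacity) :
    ∏ s ∈ range S, (1 + bSum M (s + 1) x) ≤ Real.exp (4 * x⁻¹ ^ 3 *
      ∑ T ∈ range S, (x / hexCriticalFugacity) ^ (2 * (T + 1)) * stripBlim (T + 1)) := by
  calc ∏ s ∈ range S, (1 + bSum M (s + 1) x) ≤ ∏ s ∈ range S, Real.exp (bSum M (s + 1) x) :=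
        prod_le_prod (fun s _ => by linarith [bSum_nonneg M ((s : ℤ) + 1) hx.le])
          fun s _ => by linarith [Real.add_one_le_exp (bSum M ((s : ℤ) + 1) x)]
    _ = Real.exp (∑ s ∈ range S, bSum M (s + 1) x) := (Real.exp_sum _ _).symm
    _ ≤ _ := Real.exp_le_exp.2 (sum_bSum_le_lim M S hx hxc)

/-- **MASTER INEQUALITY (Hammersley–Welsh with the critical bridge masses kept).** For
`0 < x ≤ x_c` and every `n`:
`c_n(ℍ) xⁿ ≤ 4 x⁻¹ · exp(8 x⁻³ · Σ_{T=1}^{n+1} (x/x_c)^{2T} B_T(x_c))`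
(`Z_{≤n}(x) ≤ x⁻¹ H_{n+1}(x)²`, `H ≤ 2 ∏_s (1 + bSum_s)`, `sum_bSum_le_lim`).
[cite: DuminilCopinSmirnov2012, §3 (proof of Theorem 1, "Z(x) ≤ 2 ∏ (1 + B_T^x)²")] -/
theorem hexSawCount_mul_pow_le_exp (n : ℕ) (hx : 0 < x) (hxc : x ≤ hexCriticalFugacity) :
    (hexSawCount n : ℝ) * x ^ n ≤ 4 * x⁻¹ * Real.exp (8 * x⁻¹ ^ 3 *
      ∑ T ∈ range (n + 1), (x / hexCriticalFugacity) ^ (2 * (T + 1)) * stripBlim (T + 1)) := by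
  set E := 4 * x⁻¹ ^ 3 *
    ∑ T ∈ range (n + 1), (x / hexCriticalFugacity) ^ (2 * (T + 1)) * stripBlim (T + 1) with hE
  have h1 : (hexSawCount n : ℝ) * x ^ n ≤ ∑ k ∈ range (n + 1), (hexSawCount k : ℝ) * x ^ k :=
    single_le_sum (f := fun k => (hexSawCount k : ℝ) * x ^ k) (fun k _ => by positivity)
      (mem_range.2 (Nat.lt_succ_self n))
  have h2 := sum_hexSawCount_le n hx
  have h3 : wt x (hsStd (n + 1)) ≤ 2 * Real.exp E := by
    rw [hsStd, wt_hsBoth]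
    exact (hSum_le_prod (n + 1) (n + 1) hx.le).trans
      (mul_le_mul_of_nonneg_left (prod_bSum_le_exp_lim (n + 1) (n + 1) hx hxc) (by norm_num))
  have h4 : wt x (hsStd (n + 1)) ^ 2 ≤ (2 * Real.exp E) ^ 2 :=
    pow_le_pow_left₀ (wt_nonneg hx.le _) h3 2
  have h5 : (2 * Real.exp E) ^ 2 = 4 * Real.exp (8 * x⁻¹ ^ 3 *
      ∑ T ∈ range (n + 1), (x / hexCriticalFugacity) ^ (2 * (T + 1)) * stripBlim (T + 1)) := by
    rw [mul_pow, sq (Real.exp E), ← Real.exp_add, hE]; ring_nf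
  calc (hexSawCount n : ℝ) * x ^ n ≤ x⁻¹ * wt x (hsStd (n + 1)) ^ 2 := h1.trans h2
    _ ≤ x⁻¹ * (2 * Real.exp E) ^ 2 := mul_le_mul_of_nonneg_left h4 (inv_nonneg.2 hx.le)
    _ = _ := by rw [h5]; ring

end Master

/-! ### The explicit Hammersley–Welsh form at `x = x_c (1 − t)` -/

/-- **Hammersley–Welsh on `ℍ`, explicit and for every `n`, with the critical bridge masses kept**:
for `0 < t ≤ 1/2`,
`c_n(ℍ) ≤ 8μ · exp(2nt + 64μ³ Σ_{T=1}^{n+1} (1−t)^{2T} B_T(x_c)) · μⁿ`, `μ = μ_ℍ = x_c⁻¹`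
(the master inequality at `x = x_c(1−t)`: `x⁻¹ ≤ 2μ`, `x⁻³ ≤ 8μ³`, `(1−t)^{-n} ≤ e^{2nt}`).
[cite: DuminilCopinSmirnov2012, §3 (proof of Theorem 1)] -/
theorem hexSawCount_le_exp_of_le_half (n : ℕ) {t : ℝ} (ht0 : 0 < t) (ht : t ≤ 1 / 2) :
    (hexSawCount n : ℝ) ≤ 8 * hexConnectiveConstant *
      Real.exp (2 * n * t + 64 * hexConnectiveConstant ^ 3 *
        ∑ T ∈ range (n + 1), (1 - t) ^ (2 * (T + 1)) * stripBlim (T + 1)) *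
      hexConnectiveConstant ^ n := by
  obtain ⟨hxc0, hxc1⟩ := hexCriticalFugacity_pos_lt_one
  set μ := hexConnectiveConstant with hμ
  have hμ' : μ = hexCriticalFugacity⁻¹ := hexConnectiveConstant_eq_inv
  have hμpos : 0 < μ := hexConnectiveConstant_pos
  set x := hexCriticalFugacity * (1 - t) with hxdef
  have h1t : 1 / 2 ≤ 1 - t := by linarith
  have h1t1 : 1 - t ≤ 1 := by linarith
  have h1tpos : 0 < 1 - t := by linarith
  have hx : 0 < x := mul_pos hxc0 h1tpos
  have hxc : x ≤ hexCriticalFugacity := by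
    rw [hxdef]; exact mul_le_of_le_one_right hxc0.le h1t1
  have hρ : x / hexCriticalFugacity = 1 - t := by
    rw [hxdef]; field_simp
  -- the master inequality at `x`
  have hM := hexSawCount_mul_pow_le_exp n hx hxc
  rw [hρ] at hM
  set W := ∑ T ∈ range (n + 1), (1 - t) ^ (2 * (T + 1)) * stripBlim (T + 1) with hW
  have hW0 : 0 ≤ W := sum_nonneg fun T _ =>
    mul_nonneg (pow_nonneg h1tpos.le _) (stripBlim_nonneg (by omega))
  -- `x⁻¹ = μ (1−t)⁻¹ ≤ 2μ`, `x⁻³ ≤ 8 μ³`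
  have hxinv : x⁻¹ = μ * (1 - t)⁻¹ := by rw [hxdef, hμ', mul_inv]
  have h1tinv : (1 - t)⁻¹ ≤ 2 := by
    rw [inv_le_comm₀ h1tpos (by norm_num)]; linarith
  have h1tinv0 : 0 ≤ (1 - t)⁻¹ := inv_nonneg.2 h1tpos.le
  have hx1 : x⁻¹ ≤ 2 * μ := by rw [hxinv]; nlinarith
  have hx3 : x⁻¹ ^ 3 ≤ 8 * μ ^ 3 := by
    calc x⁻¹ ^ 3 ≤ (2 * μ) ^ 3 := pow_le_pow_left₀ (inv_nonneg.2 hx.le) hx1 3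
      _ = 8 * μ ^ 3 := by ring
  -- `(1 − t)^{-n} ≤ e^{2nt}`
  have hgeom : (1 - t)⁻¹ ≤ Real.exp (2 * t) := by
    have h1 : (1 - t)⁻¹ ≤ 1 + 2 * t := by
      rw [inv_le_comm₀ h1tpos (by linarith), inv_eq_one_div, div_le_iff₀ (by linarith)]
      nlinarith
    linarith [Real.add_one_le_exp (2 * t)]
  have hpow : (x ^ n)⁻¹ ≤ Real.exp (2 * n * t) * μ ^ n := by
    rw [← inv_pow, hxinv, mul_pow, mul_comm]
    refine mul_le_mul_of_nonneg_right ?_ (pow_nonneg hμpos.le n)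
    calc ((1 - t)⁻¹) ^ n ≤ Real.exp (2 * t) ^ n := pow_le_pow_left₀ h1tinv0 hgeom n
      _ = Real.exp (2 * n * t) := by rw [← Real.exp_nat_mul]; ring_nf
  -- assemble: `c_n = (c_n xⁿ) x^{-n}`
  have hcn : (hexSawCount n : ℝ) = (hexSawCount n : ℝ) * x ^ n * (x ^ n)⁻¹ := by
    rw [mul_inv_cancel_right₀ (pow_ne_zero n hx.ne')]
  have hexp_mono : Real.exp (8 * x⁻¹ ^ 3 * W) ≤ Real.exp (64 * μ ^ 3 * W) := by
    apply Real.exp_le_exp.2; nlinarith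
  rw [hcn]
  calc (hexSawCount n : ℝ) * x ^ n * (x ^ n)⁻¹
      ≤ (4 * x⁻¹ * Real.exp (8 * x⁻¹ ^ 3 * W)) * (Real.exp (2 * n * t) * μ ^ n) :=
        mul_le_mul hM hpow (inv_nonneg.2 (pow_nonneg hx.le n)) (by positivity)
    _ ≤ (4 * (2 * μ) * Real.exp (64 * μ ^ 3 * W)) * (Real.exp (2 * n * t) * μ ^ n) := by
        refine mul_le_mul_of_nonneg_right ?_ (by positivity)
        exact mul_le_mul (mul_le_mul_of_nonneg_left hx1 (by norm_num)) hexp_mono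
          (Real.exp_pos _).le (by positivity)
    _ = 8 * μ * Real.exp (2 * n * t + 64 * μ ^ 3 * W) * μ ^ n := by
        rw [Real.exp_add]; ring

/-! ### Statement shapes (lane «pcv-sawmu», Sketch_G11 §R55) -/

/-- Explicit Hammersley–Welsh form on `ℍ`: `c_n ≤ A e^{κ√n} μ_ℍ^n` for all `n ≥ 1`.
[cite: HammersleyWelsh1962, Theorem (c_n ≤ exp(κ√n) μⁿ)] -/
def HexHWExplicit (A κ : ℝ) : Prop :=
  ∀ n : ℕ, 1 ≤ n → (hexSawCount n : ℝ) ≤ A * Real.exp (κ * Real.sqrt n) * hexConnectiveConstant ^ n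

/-- Stretched-exponential Hammersley–Welsh form on `ℍ`: `c_n ≤ A exp(K n^θ) μ_ℍ^n` for all `n ≥ 1`.
[cite: DuminilCopinGangulyHammondManolescu2020, Theorem 1.3 (shape)] -/
def HexHWStretched (A K θ : ℝ) : Prop :=
  ∀ n : ℕ, 1 ≤ n → (hexSawCount n : ℝ) ≤ A * Real.exp (K * (n : ℝ) ^ θ) * hexConnectiveConstant ^ n

/-- Polynomial decay of Duminil-Copin–Smirnov's critical bridge partition functions:
`B_T(x_c) ≤ C T^{-η}` for `T ≥ 1`. [cite: KrachunPanagiotis2026, Theorem 2 (shape)] -/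
def BridgeDecay (C η : ℝ) : Prop := ∀ T : ℕ, 1 ≤ T → HV.stripBlim T ≤ C * (T : ℝ) ^ (-η)

/-! ### The engine: polynomial bridge decay ⇒ stretched Hammersley–Welsh exponent -/

/-- `Σ_{T=1}^{M} T^{-η} ≤ M^{1−η}/(1−η)` for `0 < η < 1` (induction; the step is Bernoulli's inequality
`(1 + 1/M)^η ≤ 1 + η/M`). [folklore] -/
private theorem sum_rpow_neg_le {η : ℝ} (hη0 : 0 < η) (hη1 : η < 1) (M : ℕ) :
    ∑ T ∈ range M, ((T : ℝ) + 1) ^ (-η) ≤ ((M : ℝ)) ^ (1 - η) / (1 - η) := by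
  have h1η : 0 < 1 - η := by linarith
  induction M with
  | zero => simp [Real.zero_rpow h1η.ne']
  | succ M ih =>
    rw [sum_range_succ]
    push_cast
    -- need `(M+1)^{-η} ≤ ((M+1)^{1-η} − M^{1−η})/(1−η)`
    have hM0 : (0 : ℝ) ≤ M := Nat.cast_nonneg M
    have hM1 : (0 : ℝ) < (M : ℝ) + 1 := by positivity
    have key : (M : ℝ) ^ (1 - η) + (1 - η) * ((M : ℝ) + 1) ^ (-η) ≤ ((M : ℝ) + 1) ^ (1 - η) := by
      rcases Nat.eq_zero_or_pos M with hM | hM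
      · subst hM
        simp only [CharP.cast_eq_zero, Real.zero_rpow h1η.ne', zero_add, Real.one_rpow, mul_one]
        linarith
      · have hMpos : (0 : ℝ) < M := by exact_mod_cast hM
        -- Bernoulli: `(1 + 1/M)^η ≤ 1 + η/M`, i.e. `M (1+1/M)^η ≤ M + η`
        have hB := rpow_one_add_le_one_add_mul_self (s := (M : ℝ)⁻¹)
          (by linarith [inv_pos.2 hMpos]) hη0.le hη1.le
        have hsplit : ((M : ℝ) + 1) = M * (1 + (M : ℝ)⁻¹) := by field_simp
        -- `(M+1)^{1-η} = (M+1) (M+1)^{-η}` and `M^{1-η} = M · M^{-η}`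
        have e1 : ((M : ℝ) + 1) ^ (1 - η) = ((M : ℝ) + 1) * ((M : ℝ) + 1) ^ (-η) := by
          rw [sub_eq_add_neg, Real.rpow_add hM1, Real.rpow_one]
        have e2 : (M : ℝ) ^ (1 - η) = (M : ℝ) * (M : ℝ) ^ (-η) := by
          rw [sub_eq_add_neg, Real.rpow_add hMpos, Real.rpow_one]
        -- `M^{-η} = (M+1)^{-η} (1 + 1/M)^{η}`
        have e3 : (M : ℝ) ^ (-η) = ((M : ℝ) + 1) ^ (-η) * (1 + (M : ℝ)⁻¹) ^ η := by
          rw [hsplit, Real.mul_rpow hMpos.le (by positivity), mul_assoc, ← Real.rpow_add (by positivity),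
            neg_add_cancel, Real.rpow_zero, mul_one]
        rw [e1, e2, e3]
        have hpos : 0 ≤ ((M : ℝ) + 1) ^ (-η) := Real.rpow_nonneg hM1.le _
        have : (M : ℝ) * (1 + (M : ℝ)⁻¹) ^ η ≤ M + η := by
          calc (M : ℝ) * (1 + (M : ℝ)⁻¹) ^ η ≤ M * (1 + η * (M : ℝ)⁻¹) :=
                mul_le_mul_of_nonneg_left hB hMpos.le
            _ = M + η := by field_simp
        nlinarith
    calc ∑ T ∈ range M, ((T : ℝ) + 1) ^ (-η) + ((M : ℝ) + 1) ^ (-η)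
        ≤ (M : ℝ) ^ (1 - η) / (1 - η) + ((M : ℝ) + 1) ^ (-η) := by linarith
      _ ≤ ((M : ℝ) + 1) ^ (1 - η) / (1 - η) := by
          rw [div_add' _ _ _ h1η.ne', div_le_div_iff_of_pos_right h1η]
          linarith

/-- The Laplace-type sum bound behind the engine: for `0 < t ≤ 1/2`, `0 < η < 1` and every `N`,
`Σ_{T=1}^{N} (1−t)^{2T} T^{-η} ≤ (2^{1−η}/(1−η) + 1)·t^{η−1}` (split at `M = ⌈1/t⌉`: the head by
`sum_rpow_neg_le`, the tail by `M^{-η} Σ_{T>M} (1−t)^{2T} ≤ t^η/t`). [folklore] -/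
private theorem sum_geom_rpow_le {t η : ℝ} (ht0 : 0 < t) (ht : t ≤ 1 / 2) (hη0 : 0 < η) (hη1 : η < 1)
    (N : ℕ) :
    ∑ T ∈ range N, (1 - t) ^ (2 * (T + 1)) * ((T : ℝ) + 1) ^ (-η) ≤
      ((2 : ℝ) ^ (1 - η) / (1 - η) + 1) * t ^ (η - 1) := by
  have h1η : 0 < 1 - η := by linarith
  have h1t : 0 < 1 - t := by linarith
  have h1t1 : 1 - t ≤ 1 := by linarith
  set M := ⌈t⁻¹⌉₊ with hM
  have htinv : 1 ≤ t⁻¹ := (one_le_inv₀ ht0).2 (by linarith)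
  have hMge : t⁻¹ ≤ (M : ℝ) := Nat.le_ceil _
  have hMle : (M : ℝ) ≤ t⁻¹ + 1 := (Nat.ceil_lt_add_one (by positivity)).le
  have hM1 : (1 : ℝ) ≤ M := htinv.trans hMge
  have hMpos : (0 : ℝ) < M := by linarith
  have hterm0 : ∀ T : ℕ, 0 ≤ (1 - t) ^ (2 * (T + 1)) * ((T : ℝ) + 1) ^ (-η) := fun T =>
    mul_nonneg (pow_nonneg h1t.le _) (Real.rpow_nonneg (by positivity) _)
  -- split the range at `M`
  have hsplit : ∑ T ∈ range N, (1 - t) ^ (2 * (T + 1)) * ((T : ℝ) + 1) ^ (-η) ≤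
      ∑ T ∈ range M, (1 - t) ^ (2 * (T + 1)) * ((T : ℝ) + 1) ^ (-η) +
        ∑ T ∈ Ico M (M + N), (1 - t) ^ (2 * (T + 1)) * ((T : ℝ) + 1) ^ (-η) := by
    rw [← sum_union (disjoint_left.2 fun a ha hb => by
      rw [mem_range] at ha; rw [mem_Ico] at hb; omega)]
    refine sum_le_sum_of_subset_of_nonneg (fun T hT => ?_) fun T _ _ => hterm0 T
    rw [mem_union, mem_range, mem_Ico]; rw [mem_range] at hT; omega
  -- head: `(1−t)^{2T} ≤ 1`, then `sum_rpow_neg_le`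
  have hhead : ∑ T ∈ range M, (1 - t) ^ (2 * (T + 1)) * ((T : ℝ) + 1) ^ (-η) ≤
      (2 : ℝ) ^ (1 - η) / (1 - η) * t ^ (η - 1) := by
    calc ∑ T ∈ range M, (1 - t) ^ (2 * (T + 1)) * ((T : ℝ) + 1) ^ (-η)
        ≤ ∑ T ∈ range M, ((T : ℝ) + 1) ^ (-η) :=
          sum_le_sum fun T _ => mul_le_of_le_one_left (Real.rpow_nonneg (by positivity) _)
            (pow_le_one₀ h1t.le h1t1)
      _ ≤ (M : ℝ) ^ (1 - η) / (1 - η) := sum_rpow_neg_le hη0 hη1 M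
      _ ≤ (2 * t⁻¹) ^ (1 - η) / (1 - η) := by
          refine div_le_div_of_nonneg_right ?_ h1η.le
          exact Real.rpow_le_rpow hMpos.le (by linarith) h1η.le
      _ = (2 : ℝ) ^ (1 - η) / (1 - η) * t ^ (η - 1) := by
          rw [Real.mul_rpow (by norm_num) (by positivity), Real.inv_rpow ht0.le, ← Real.rpow_neg ht0.le,
            neg_sub]
          ring
  -- tail: `T ≥ M ⇒ (T+1)^{-η} ≤ M^{-η} ≤ t^{η}` and `Σ_{T ≥ M} (1−t)^{2(T+1)} ≤ 1/t`
  have htail : ∑ T ∈ Ico M (M + N), (1 - t) ^ (2 * (T + 1)) * ((T : ℝ) + 1) ^ (-η) ≤ t ^ (η - 1) := by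
    have hMη : ∀ T ∈ Ico M (M + N), ((T : ℝ) + 1) ^ (-η) ≤ t ^ η := by
      intro T hT
      rw [mem_Ico] at hT
      have hTM : (M : ℝ) ≤ (T : ℝ) + 1 := by exact_mod_cast (by omega : M ≤ T + 1)
      calc ((T : ℝ) + 1) ^ (-η) ≤ (t⁻¹) ^ (-η) :=
            Real.rpow_le_rpow_of_nonpos (by positivity) (hMge.trans hTM) (by linarith)
        _ = t ^ η := by rw [Real.inv_rpow ht0.le, ← Real.rpow_neg ht0.le, neg_neg]
    have hgeom : ∑ T ∈ Ico M (M + N), (1 - t) ^ (2 * (T + 1)) ≤ t⁻¹ := by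
      have hq1 : (1 - t) ^ 2 < 1 := by nlinarith
      have hq0 : 0 ≤ (1 - t) ^ 2 := sq_nonneg _
      have hq1' : (1 - t) ^ 2 ≤ 1 := hq1.le
      calc ∑ T ∈ Ico M (M + N), (1 - t) ^ (2 * (T + 1))
          ≤ ∑ T ∈ Ico M (M + N), ((1 - t) ^ 2) ^ T := by
            refine sum_le_sum fun T _ => ?_
            rw [pow_mul]
            exact pow_le_pow_of_le_one hq0 hq1' (Nat.le_succ T)
        _ ≤ ((1 - t) ^ 2) ^ M / (1 - (1 - t) ^ 2) := geom_sum_Ico_le_of_lt_one hq0 hq1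
        _ ≤ 1 / (1 - (1 - t) ^ 2) :=
            div_le_div_of_nonneg_right (pow_le_one₀ hq0 hq1') (by nlinarith)
        _ ≤ t⁻¹ := by
            rw [one_div, inv_le_inv₀ (by nlinarith) ht0]; nlinarith
    calc ∑ T ∈ Ico M (M + N), (1 - t) ^ (2 * (T + 1)) * ((T : ℝ) + 1) ^ (-η)
        ≤ ∑ T ∈ Ico M (M + N), (1 - t) ^ (2 * (T + 1)) * t ^ η :=
          sum_le_sum fun T hT => mul_le_mul_of_nonneg_left (hMη T hT) (pow_nonneg h1t.le _)
      _ = (∑ T ∈ Ico M (M + N), (1 - t) ^ (2 * (T + 1))) * t ^ η := by rw [sum_mul]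
      _ ≤ t⁻¹ * t ^ η := mul_le_mul_of_nonneg_right hgeom (Real.rpow_nonneg ht0.le _)
      _ = t ^ (η - 1) := by
          rw [sub_eq_add_neg, Real.rpow_add ht0, Real.rpow_neg_one]; ring
  calc ∑ T ∈ range N, (1 - t) ^ (2 * (T + 1)) * ((T : ℝ) + 1) ^ (-η)
      ≤ (2 : ℝ) ^ (1 - η) / (1 - η) * t ^ (η - 1) + t ^ (η - 1) := hsplit.trans (add_le_add hhead htail)
    _ = ((2 : ℝ) ^ (1 - η) / (1 - η) + 1) * t ^ (η - 1) := by ring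

/-- **THE ENGINE WITH ITS CONSTANTS EXPOSED**: under `BridgeDecay C η` (`0 < η < 1`, `0 < C`),
`c_n(ℍ) ≤ 8μ_ℍ · exp((1 + 128 μ_ℍ³ C (2^{1−η}/(1−η) + 1)) · n^{(1−η)/(2−η)}) · μ_ℍⁿ` for ALL `n ≥ 1`
(`t := ½ n^{-1/(2−η)}` in `hexSawCount_le_exp_of_le_half`; `Σ_{T≤N}(1−t)^{2T}T^{-η} ≤ (2^{1−η}/(1−η)+1) t^{η−1}`).
[cite: KrachunPanagiotis2026, Theorem 2 (p. 3) and §1] -/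
theorem hexHWStretched_explicit_of_bridgeDecay {C η : ℝ} (hC : 0 < C) (hη0 : 0 < η) (hη1 : η < 1)
    (h : BridgeDecay C η) :
    HexHWStretched (8 * hexConnectiveConstant)
      (1 + 128 * hexConnectiveConstant ^ 3 * C * ((2 : ℝ) ^ (1 - η) / (1 - η) + 1)) ((1 - η) / (2 - η)) := by
  set μ := hexConnectiveConstant with hμ
  have hμpos : 0 < μ := hexConnectiveConstant_pos
  set D : ℝ := (2 : ℝ) ^ (1 - η) / (1 - η) + 1 with hD
  have h1η : 0 < 1 - η := by linarith
  have h2η : 0 < 2 - η := by linarith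
  have hD0 : 0 < D := by positivity
  intro n hn
  set θ := (1 - η) / (2 - η) with hθ
  have hnpos : (0 : ℝ) < n := by exact_mod_cast hn
  -- `t := ½ n^{-1/(2-η)}`
  set t := (1 / 2 : ℝ) * (n : ℝ) ^ (-(1 : ℝ) / (2 - η)) with htdef
  have hnr : (n : ℝ) ^ (-(1 : ℝ) / (2 - η)) ≤ 1 :=
    Real.rpow_le_one_of_one_le_of_nonpos (by exact_mod_cast hn) (by
      rw [neg_div]; exact neg_nonpos.2 (div_nonneg zero_le_one h2η.le))
  have hnr0 : 0 < (n : ℝ) ^ (-(1 : ℝ) / (2 - η)) := Real.rpow_pos_of_pos hnpos _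
  have ht0 : 0 < t := by positivity
  have ht : t ≤ 1 / 2 := by rw [htdef]; nlinarith
  have hmain := hexSawCount_le_exp_of_le_half n ht0 ht
  -- bound the bridge sum by the decay hypothesis and `sum_geom_rpow_le`
  have hW : ∑ T ∈ range (n + 1), (1 - t) ^ (2 * (T + 1)) * stripBlim (T + 1) ≤ C * (D * t ^ (η - 1)) := by
    calc ∑ T ∈ range (n + 1), (1 - t) ^ (2 * (T + 1)) * stripBlim (T + 1)
        ≤ ∑ T ∈ range (n + 1), (1 - t) ^ (2 * (T + 1)) * (C * ((T : ℝ) + 1) ^ (-η)) := by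
          refine sum_le_sum fun T _ => mul_le_mul_of_nonneg_left ?_ (pow_nonneg (by linarith) _)
          have := h (T + 1) (by omega); push_cast at this; exact this
      _ = C * ∑ T ∈ range (n + 1), (1 - t) ^ (2 * (T + 1)) * ((T : ℝ) + 1) ^ (-η) := by
          rw [mul_sum]; exact sum_congr rfl fun T _ => by ring
      _ ≤ C * (D * t ^ (η - 1)) :=
          mul_le_mul_of_nonneg_left (sum_geom_rpow_le ht0 ht hη0 hη1 (n + 1)) hC.le
  -- `n t = ½ n^θ` and `t^{η-1} = 2^{1-η} n^{θ} ≤ 2 n^θ`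
  have hexp1 : (1 : ℝ) + -(1 : ℝ) / (2 - η) = θ := by rw [hθ]; field_simp; ring
  have hnn : (n : ℝ) * (n : ℝ) ^ (-(1 : ℝ) / (2 - η)) = (n : ℝ) ^ θ := by
    rw [← hexp1, Real.rpow_add hnpos, Real.rpow_one]
  have hnt : (n : ℝ) * t = (1 / 2) * (n : ℝ) ^ θ := by
    rw [htdef, ← hnn]; ring
  have htη : t ^ (η - 1) ≤ 2 * (n : ℝ) ^ θ := by
    rw [htdef, Real.mul_rpow (by norm_num) hnr0.le, ← Real.rpow_mul hnpos.le]
    have e : -(1 : ℝ) / (2 - η) * (η - 1) = θ := by rw [hθ]; field_simp; ring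
    rw [e]
    have h2 : (1 / 2 : ℝ) ^ (η - 1) ≤ 2 := by
      rw [one_div, Real.inv_rpow (by norm_num), ← Real.rpow_neg (by norm_num), neg_sub]
      calc (2 : ℝ) ^ (1 - η) ≤ (2 : ℝ) ^ (1 : ℝ) :=
            Real.rpow_le_rpow_of_exponent_le (by norm_num) (by linarith)
        _ = 2 := Real.rpow_one 2
    exact mul_le_mul_of_nonneg_right h2 (Real.rpow_nonneg hnpos.le _)
  have hnθ0 : 0 ≤ (n : ℝ) ^ θ := Real.rpow_nonneg hnpos.le _
  -- the exponent is at most `(1 + 128 μ³ C D) n^θ`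
  have hexpo : 2 * n * t + 64 * μ ^ 3 * ∑ T ∈ range (n + 1), (1 - t) ^ (2 * (T + 1)) * stripBlim (T + 1)
      ≤ (1 + 128 * μ ^ 3 * C * D) * (n : ℝ) ^ θ := by
    have h1 : 2 * (n : ℝ) * t = (n : ℝ) ^ θ := by rw [mul_assoc, hnt]; ring
    have h2 : 64 * μ ^ 3 * ∑ T ∈ range (n + 1), (1 - t) ^ (2 * (T + 1)) * stripBlim (T + 1) ≤
        64 * μ ^ 3 * (C * (D * (2 * (n : ℝ) ^ θ))) := by
      refine mul_le_mul_of_nonneg_left (hW.trans ?_) (by positivity)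
      exact mul_le_mul_of_nonneg_left (mul_le_mul_of_nonneg_left htη hD0.le) hC.le
    rw [h1]; nlinarith
  calc (hexSawCount n : ℝ)
      ≤ 8 * μ * Real.exp (2 * n * t + 64 * μ ^ 3 *
          ∑ T ∈ range (n + 1), (1 - t) ^ (2 * (T + 1)) * stripBlim (T + 1)) * μ ^ n := hmain
    _ ≤ 8 * μ * Real.exp ((1 + 128 * μ ^ 3 * C * D) * (n : ℝ) ^ θ) * μ ^ n := by
        refine mul_le_mul_of_nonneg_right (mul_le_mul_of_nonneg_left (Real.exp_le_exp.2 hexpo)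
          (by positivity)) (pow_nonneg hμpos.le n)


/-- **THE ENGINE: a polynomial decay `B_T(x_c) ≤ C T^{-η}` (`0 < η < 1`) of the critical bridge
partition functions gives the STRETCHED Hammersley–Welsh exponent `θ = (1−η)/(2−η) < 1/2` for ALL
`n ≥ 1`**, with `A = 8μ` and `K = 1 + 128 μ³ C (2^{1−η}/(1−η) + 1)` explicit
(`t := ½ n^{-1/(2−η)}` in `hexSawCount_le_exp_of_le_half`). The typed consumer of every bridge-decay
input (Krachun–Panagiotis' `η = 10^{-10}` as printed, the tree's `7/10⁹`, the conjectural `η = 1/4`).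
[cite: KrachunPanagiotis2026, Theorem 2 (p. 3) and §1] -/
theorem hexHWStretched_of_bridgeDecay {C η : ℝ} (hC : 0 < C) (hη0 : 0 < η) (hη1 : η < 1)
    (h : BridgeDecay C η) : ∃ A K : ℝ, HexHWStretched A K ((1 - η) / (2 - η)) :=
  ⟨_, _, hexHWStretched_explicit_of_bridgeDecay hC hη0 hη1 h⟩

end Literature.Probability.RandomPlanarGeometry.SAW

end
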